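import Summits.AtomisticToContinuum.FouriersLaw.Theorems.JunctionLocalityNonBallisticOfWindow
import Summits.AtomisticToContinuum.FouriersLaw.Theorems.JunctionLocalityNonBallisticWindowOfLocalityAndDrude
import Summits.AtomisticToContinuum.FouriersLaw.Theorems.JunctionLocalityNonBallisticStubAutocorrelationDomination
import Summits.AtomisticToContinuum.FouriersLaw.Theorems.JunctionLocalityNonBallisticStubInfiniteVolumeWitness
import Summits.AtomisticToContinuum.FouriersLaw.Theorems.JunctionLocalityNonBallisticStubWindowLimitOfPointwise
import Summits.AtomisticToContinuum.FouriersLaw.Theorems.JunctionLocalityNonBallisticStubCesaroTwoOfCesaroOne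
import Summits.AtomisticToContinuum.FouriersLaw.Theorems.JunctionLocalityNonBallisticStubBulkWindowDynamicalMatching
import Summits.AtomisticToContinuum.FouriersLaw.Theorems.JunctionLocalityNonBallisticStubBulkAnchorMatchingOfDynamicalMatching
import Summits.AtomisticToContinuum.FouriersLaw.Theorems.JunctionLocalityNonBallisticStubFixedTimeThermodynamicLimitOfBulkMatching
import Summits.AtomisticToContinuum.FouriersLaw.Theses.CurrentTiltQuench

/-!
# `NonBallistic` (stmt-AtomisticToContinuum-9127) from (K) and ZERO DRUDE WEIGHT OF THE INFINITE PINNED CHAIN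

Line `drude-controls-conductance` of the crux `JunctionLocality.NonBallistic` (shared verbatim by `PuiseuxTransferLedger` /
`BondHeatUncertainty`), reshape R2 (lead c3). After R1 (lead c2) the crux was kernel-reduced to (K) ∧ W
(`nonBallistic_of_subballisticTransitWindow`, W = `DrudeLine.SubballisticTransitWindow`, the windowed sub-ballistic equilibrium variance of
the OPEN chain — crux-sized as one statement). R2 cut W along the tree's infinite-chain library and the open/closed matching pipeline of
crux `EmbeddedDrudeMourre.AbelThermodynamicLimit`; ALL the thermodynamic-limit pieces are now theorems of the tree:

* DOM `stub_autocorrelationDomination` — `|C_N(s)| ≤ B·N`;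
* WIT `stub_infiniteVolumeWitness` — an admissible infinite-volume pair exists at every `T > 0` (shift-invariant, reversal-invariant DLR
  state `μ_T`; Buttà–Marchioro dynamics with carrier in `𝒳₀`, preserving `μ_T`, commuting with the shift a.e.; ABSOLUTELY convergent current
  correlations at every fixed time);
* FTL∞ `stub_fixedTimeThermodynamicLimit` = F2 (F1′ F1a) (`stub_fixedTimeThermodynamicLimitOfBulkMatching`,
  `stub_bulkAnchorMatchingOfDynamicalMatching`, `stub_bulkWindowDynamicalMatching`) — at every fixed lag `s ≥ 0` the per-site equilibrium
  total-current autocorrelation of the open chain converges to the Green–Kubo integrand of the infinite chain, `C_N(s)/N → D.currentCorrelation μ s`;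
* A1 `stub_windowLimitOfPointwise`, A2 `stub_cesaroTwoOfCesaroOne` — real analysis.

Consequences recorded here, sorry-free:

1. `fixedTimeThermodynamicLimit` (FTL∞, unconditional) and **`fixedTimeCurrentLocality_holds`** — the crux-strategist's child
   `FixedTimeCurrentLocality` of the crux (DECOMPOSITION.md; "L–XL, provable technology") HOLDS: `∃ v, ∀ t > 0, V_N(t)/N → v(t)`.
2. **`nonBallistic_of_extensiveSnapshotIrreversibility_of_zeroDrudeWeight`**: (K) (`BondHeatUncertainty.ExtensiveSnapshotIrreversibility`,
   route item stmt-AtomisticToContinuum-9121, by name) and ZERO DRUDE WEIGHT OF THE INFINITE CHAIN (Z: for every admissible pair the Cesàro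
   mean of the Green–Kubo integrand vanishes, `τ⁻¹∫₀^τ C_∞ → 0`; the ONLY statement using `lam, β > 0`; false for the harmonic member) give
   the crux. Z is the registered stub `stub_zeroDrudeWeightInfiniteChain` of the line, spelled verbatim.
3. **`zeroDrudeWeightInfiniteChain_of_currentTiltQuench`**: Z is VERBATIM the consequent of route `CurrentTiltQuench`'s support item
   `DrudeFromTruncation` (stmt-AtomisticToContinuum-11032) under its hypotheses minus the `NoTruncatedDrude` body (stmt-11030), so
   `Z ⟸ 11032 ∧ 11030`; hence **`nonBallistic_of_extensiveSnapshotIrreversibility_of_currentTiltQuench`**: `NonBallistic ⟸ 9121 ∧ 11030 ∧ 11032`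
   — the crux is kernel-reduced to FILED ITEMS OF OTHER ROUTES.

Nothing here closes the item. No definitions; all hypotheses are spelled verbatim.
-/

noncomputable section

namespace Summit.AtomisticToContinuum.FouriersLaw.Theorems.NonBallistic

open MeasureTheory ProbabilityTheory Filter Topology
open scoped NNReal ENNReal BigOperators
open Literature.MathematicalPhysics.KineticTheory
open Literature.MathematicalPhysics.KineticTheory.HeatConduction
open Summit.AtomisticToContinuum.FouriersLaw.Theorems.NonBallistic.DrudeLine

/-! ### §1 The fixed-time thermodynamic limit (unconditional) -/

/-- **Fixed-time thermodynamic limit of the per-site current autocorrelation of the open chain** (FTL∞, unconditional: F2 (F1′ F1a)). For the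
pinned anharmonic chain (all parameters `> 0`), `T > 0`, the equilibrium total-current autocorrelation `C` of the open chain pinned by its defining
equation, and every admissible infinite-volume pair `(μ, D)`: `C_N(s)/N → D.currentCorrelation μ s` for every `s ≥ 0`. [folklore] -/
theorem fixedTimeThermodynamicLimit :
    ∀ ω₂ lam β γ : ℝ, 0 < ω₂ → 0 < lam → 0 < β → 0 < γ → ∀ T : ℝ, 0 < T →
    ∀ C : ℕ → ℝ → ℝ,
      C = (fun (N : ℕ) (s : ℝ) => ∫ x, (∑ i : Fin N, (pinnedChain ω₂ lam β γ).bondCurrent N i x) *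
            (∫ y, (∑ i : Fin N, (pinnedChain ω₂ lam β γ).bondCurrent N i y)
              ∂((pinnedChain ω₂ lam β γ).transitionKernel N T T s.toNNReal x))
            ∂((pinnedChain ω₂ lam β γ).gibbsMeasure N T)) →
      ∀ (μ : Measure ChainConfig) (D : InfiniteChainDynamics (pinnedChain ω₂ lam β γ)),
        (pinnedChain ω₂ lam β γ).IsChainGibbsMeasure T μ → IsShiftInvariant μ →
        D.carrier ⊆ (pinnedChain ω₂ lam β γ).bmGood → D.PreservesMeasure μ →
        (∀ t : ℝ, D.HasAbsConvergentCorrelation μ t) →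
        ∀ s : ℝ, 0 ≤ s →
          Tendsto (fun N : ℕ => C N s / (N : ℝ)) atTop (𝓝 (D.currentCorrelation μ s)) :=
  stub_fixedTimeThermodynamicLimitOfBulkMatching (stub_bulkAnchorMatchingOfDynamicalMatching stub_bulkWindowDynamicalMatching)

/-- Measurability of the limit: the Green–Kubo integrand restricted to `s ≥ 0` is the pointwise limit of the measurable functions
`𝟙_{s ≥ 0} C_N(s)/N`. [folklore] -/
theorem DrudeWindow.measurable_indicator_of_pointwise_limit {C : ℕ → ℝ → ℝ} {c : ℝ → ℝ} (hcont : ∀ N : ℕ, Continuous (C N))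
    (hlim : ∀ s : ℝ, 0 ≤ s → Tendsto (fun N : ℕ => C N s / (N : ℝ)) atTop (𝓝 (c s))) :
    Measurable (Set.indicator (Set.Ici (0 : ℝ)) c) := by
  refine measurable_of_tendsto_metrizable
    (f := fun N : ℕ => Set.indicator (Set.Ici (0 : ℝ)) (fun s => C N s / (N : ℝ))) ?_ ?_
  · intro N
    exact ((hcont N).measurable.div_const _).indicator measurableSet_Ici
  · rw [tendsto_pi_nhds]
    intro s
    by_cases hs : 0 ≤ s
    · have hs' : s ∈ Set.Ici (0 : ℝ) := Set.mem_Ici.2 hs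
      simp only [Set.indicator_of_mem hs']
      exact hlim s hs
    · have hs' : s ∉ Set.Ici (0 : ℝ) := fun h => hs (Set.mem_Ici.1 h)
      simp only [Set.indicator_of_notMem hs']
      exact tendsto_const_nhds

/-- **`FixedTimeCurrentLocality` HOLDS** — the crux-strategist's child of `NonBallistic` (text VERBATIM `Theorems/JunctionLocalityNonBallisticSplit.lean`,
hypothesis 2 of `nonBallistic_of_subs`): the per-site window variance `V_N(t)/N = (2∫₀ᵗ (t-s) C_N(s) ds)/N` of the time-integrated equilibrium
total current of the open chain has a thermodynamic limit `v(t)` at every fixed `t > 0` (`v(t) = 2∫₀ᵗ (t-s) C_∞(s) ds` along an admissible pair;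
dominated convergence with DOM). [folklore] -/
theorem fixedTimeCurrentLocality_holds :
    ∀ ω₂ lam β γ : ℝ, 0 < ω₂ → 0 < lam → 0 < β → 0 < γ → ∀ T : ℝ, 0 < T →
    ∀ C : ℕ → ℝ → ℝ,
      C = (fun (N : ℕ) (s : ℝ) => ∫ x, (∑ i : Fin N, (pinnedChain ω₂ lam β γ).bondCurrent N i x) *
            (∫ y, (∑ i : Fin N, (pinnedChain ω₂ lam β γ).bondCurrent N i y)
              ∂((pinnedChain ω₂ lam β γ).transitionKernel N T T s.toNNReal x))
            ∂((pinnedChain ω₂ lam β γ).gibbsMeasure N T)) →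
      ∃ v : ℝ → ℝ, ∀ t : ℝ, 0 < t →
        Tendsto (fun N : ℕ => (2 * ∫ s in (0 : ℝ)..t, (t - s) * C N s) / (N : ℝ)) atTop (𝓝 (v t)) := by
  intro ω₂ lam β γ hω hl hβ hγ T hT C hC
  obtain ⟨μ, D, hG, hS, -, hcar, hP, -, hAC⟩ := stub_infiniteVolumeWitness ω₂ lam β γ hω hl hβ hγ T hT
  obtain ⟨B, hB⟩ := stub_autocorrelationDomination ω₂ lam β γ hω hl hβ hγ T hT C hC
  have hlim := fixedTimeThermodynamicLimit ω₂ lam β γ hω hl hβ hγ T hT C hC μ D hG hS hcar hP hAC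
  have hcont : ∀ N : ℕ, Continuous (C N) := stub_autocorrelationContinuous ω₂ lam β γ hω hl hβ hγ T hT C hC
  set g : ℝ → ℝ := Set.indicator (Set.Ici (0 : ℝ)) (D.currentCorrelation μ) with hg
  have hgm : Measurable g := DrudeWindow.measurable_indicator_of_pointwise_limit hcont hlim
  have hlim' : ∀ s : ℝ, 0 ≤ s → Tendsto (fun N : ℕ => C N s / (N : ℝ)) atTop (𝓝 (g s)) := fun s hs => by
    rw [hg, Set.indicator_of_mem (Set.mem_Ici.2 hs)]
    exact hlim s hs
  exact ⟨fun t => 2 * ∫ s in (0 : ℝ)..t, (t - s) * g s,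
    fun t ht => stub_windowLimitOfPointwise C g B hcont hgm hB hlim' t ht⟩

/-! ### §2 Zero Drude weight of the infinite chain gives the windowed statement W, hence (with (K)) the crux -/

/-- **`ZeroDrudeWeightLiminf` from zero Drude weight of the infinite chain** (the strategist's child 2b, text VERBATIM hypothesis 3 of
`nonBallistic_of_subs`): if for every admissible pair the Cesàro mean of the Green–Kubo integrand vanishes (Z), then every fixed-time limit `v` of
`V_N(t)/N` satisfies `∀ ε > 0 ∃ t > 0, v(t) ≤ ε t²` (uniqueness of limits identifies `v` with `2∫₀ᵗ(t-s)C_∞`, then A2). [folklore] -/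
theorem zeroDrudeWeightLiminf_of_zeroDrudeWeightInfiniteChain
    (hZ : ∀ ω₂ lam β γ : ℝ, 0 < ω₂ → 0 < lam → 0 < β → ∀ T : ℝ, 0 < T →
      ∀ μ : Measure ChainConfig, (pinnedChain ω₂ lam β γ).IsChainGibbsMeasure T μ → IsShiftInvariant μ →
        μ.map (fun σ : ChainConfig => fun x : ℤ => ((σ x).1, -(σ x).2)) = μ →
        ∀ D : InfiniteChainDynamics (pinnedChain ω₂ lam β γ), D.PreservesMeasure μ →
          (∀ t : ℝ, ∀ᵐ σ ∂μ, D.flow t (shift σ) = shift (D.flow t σ)) →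
          (∀ t : ℝ, D.HasAbsConvergentCorrelation μ t) →
          Tendsto (fun τ : ℝ => τ⁻¹ * ∫ t in (0:ℝ)..τ, D.currentCorrelation μ t) atTop (𝓝 0)) :
    ∀ ω₂ lam β γ : ℝ, 0 < ω₂ → 0 < lam → 0 < β → 0 < γ → ∀ T : ℝ, 0 < T →
    ∀ C : ℕ → ℝ → ℝ,
      C = (fun (N : ℕ) (s : ℝ) => ∫ x, (∑ i : Fin N, (pinnedChain ω₂ lam β γ).bondCurrent N i x) *
            (∫ y, (∑ i : Fin N, (pinnedChain ω₂ lam β γ).bondCurrent N i y)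
              ∂((pinnedChain ω₂ lam β γ).transitionKernel N T T s.toNNReal x))
            ∂((pinnedChain ω₂ lam β γ).gibbsMeasure N T)) →
      ∀ v : ℝ → ℝ,
        (∀ t : ℝ, 0 < t →
          Tendsto (fun N : ℕ => (2 * ∫ s in (0 : ℝ)..t, (t - s) * C N s) / (N : ℝ)) atTop (𝓝 (v t))) →
        ∀ ε : ℝ, 0 < ε → ∃ t : ℝ, 0 < t ∧ v t ≤ ε * t ^ 2 := by
  intro ω₂ lam β γ hω hl hβ hγ T hT C hC v hv ε hε
  obtain ⟨μ, D, hG, hS, hR, hcar, hP, hcomm, hAC⟩ := stub_infiniteVolumeWitness ω₂ lam β γ hω hl hβ hγ T hT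
  obtain ⟨B, hB⟩ := stub_autocorrelationDomination ω₂ lam β γ hω hl hβ hγ T hT C hC
  have hlim := fixedTimeThermodynamicLimit ω₂ lam β γ hω hl hβ hγ T hT C hC μ D hG hS hcar hP hAC
  have hcont : ∀ N : ℕ, Continuous (C N) := stub_autocorrelationContinuous ω₂ lam β γ hω hl hβ hγ T hT C hC
  set g : ℝ → ℝ := Set.indicator (Set.Ici (0 : ℝ)) (D.currentCorrelation μ) with hg
  have hgm : Measurable g := DrudeWindow.measurable_indicator_of_pointwise_limit hcont hlim
  have hg_of : ∀ s : ℝ, 0 ≤ s → g s = D.currentCorrelation μ s := fun s hs => by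
    rw [hg, Set.indicator_of_mem (Set.mem_Ici.2 hs)]
  have hlim' : ∀ s : ℝ, 0 ≤ s → Tendsto (fun N : ℕ => C N s / (N : ℝ)) atTop (𝓝 (g s)) := fun s hs => by
    rw [hg_of s hs]
    exact hlim s hs
  -- the `N`-uniform bound passes to the limit
  have hgB : ∀ s : ℝ, 0 ≤ s → |g s| ≤ B := fun s hs => by
    have h1 : Tendsto (fun N : ℕ => |C N s / (N : ℝ)|) atTop (𝓝 (|g s|)) :=
      (continuous_abs.tendsto _).comp (hlim' s hs)
    refine le_of_tendsto h1 ?_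
    filter_upwards [eventually_ge_atTop 1] with N hN
    have hNpos : (0 : ℝ) < (N : ℝ) := by exact_mod_cast hN
    rw [abs_div, abs_of_pos hNpos, div_le_iff₀ hNpos]
    exact hB N s hs
  -- zero Drude weight at the admissible pair, transported to `g`
  have hces0 := hZ ω₂ lam β γ hω hl hβ T hT μ hG hS hR D hP hcomm hAC
  have hces : Tendsto (fun τ : ℝ => τ⁻¹ * ∫ t in (0:ℝ)..τ, g t) atTop (𝓝 0) := by
    refine hces0.congr' ?_
    filter_upwards [eventually_ge_atTop (0 : ℝ)] with τ hτ
    congr 1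
    refine intervalIntegral.integral_congr fun t ht => ?_
    rw [Set.uIcc_of_le hτ] at ht
    exact (hg_of t ht.1).symm
  -- a good time for `g`, and uniqueness of the fixed-time limit
  obtain ⟨t, ht, hvt⟩ := stub_cesaroTwoOfCesaroOne g B hgm hgB hces ε hε
  have hmine : Tendsto (fun N : ℕ => (2 * ∫ s in (0 : ℝ)..t, (t - s) * C N s) / (N : ℝ)) atTop
      (𝓝 (2 * ∫ s in (0 : ℝ)..t, (t - s) * g s)) := stub_windowLimitOfPointwise C g B hcont hgm hB hlim' t ht
  have heq : v t = 2 * ∫ s in (0 : ℝ)..t, (t - s) * g s := tendsto_nhds_unique (hv t ht) hmine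
  exact ⟨t, ht, heq ▸ hvt⟩

/-- **W from Z**: zero Drude weight of the infinite chain gives R1's open stub `DrudeLine.SubballisticTransitWindow` (through the landed p123204
`subballisticTransitWindow_of_fixedTimeLocality_of_zeroDrudeWeight`). [folklore] -/
theorem subballisticTransitWindow_of_zeroDrudeWeightInfiniteChain
    (hZ : ∀ ω₂ lam β γ : ℝ, 0 < ω₂ → 0 < lam → 0 < β → ∀ T : ℝ, 0 < T →
      ∀ μ : Measure ChainConfig, (pinnedChain ω₂ lam β γ).IsChainGibbsMeasure T μ → IsShiftInvariant μ →
        μ.map (fun σ : ChainConfig => fun x : ℤ => ((σ x).1, -(σ x).2)) = μ →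
        ∀ D : InfiniteChainDynamics (pinnedChain ω₂ lam β γ), D.PreservesMeasure μ →
          (∀ t : ℝ, ∀ᵐ σ ∂μ, D.flow t (shift σ) = shift (D.flow t σ)) →
          (∀ t : ℝ, D.HasAbsConvergentCorrelation μ t) →
          Tendsto (fun τ : ℝ => τ⁻¹ * ∫ t in (0:ℝ)..τ, D.currentCorrelation μ t) atTop (𝓝 0)) :
    SubballisticTransitWindow :=
  subballisticTransitWindow_of_fixedTimeLocality_of_zeroDrudeWeight fixedTimeCurrentLocality_holds
    (zeroDrudeWeightLiminf_of_zeroDrudeWeightInfiniteChain hZ)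

/-- **`NonBallistic` from (K) and ZERO DRUDE WEIGHT OF THE INFINITE PINNED CHAIN.** The route item (K)
`BondHeatUncertainty.ExtensiveSnapshotIrreversibility` (stmt-AtomisticToContinuum-9121, by name) and Z (for every shift-invariant,
momentum-reversal-invariant DLR state `μ` at `T > 0` of `pinnedChain ω₂ lam β γ` (`ω₂, lam, β > 0`) and every `μ`-preserving dynamics commuting
with the shift a.e. with absolutely convergent current correlations, `τ⁻¹ ∫₀^τ D.currentCorrelation μ t dt → 0`) imply the crux
`JunctionLocality.NonBallistic` (stmt-AtomisticToContinuum-9127): the total-current fluctuation-theorem uncertainty relation (landed lever of the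
line) at a FIXED time `t(ε)`, the fixed-time thermodynamic limit (§1) and zero Drude weight make the per-site window variance `≤ εNt²` for all large
`N`, which a conductance floor forbids under (K). Z is the registered stub `stub_zeroDrudeWeightInfiniteChain` of line `drude-controls-conductance`
(the ONLY statement of the line using `lam, β > 0`). [folklore] -/
theorem nonBallistic_of_extensiveSnapshotIrreversibility_of_zeroDrudeWeight
    (hK : Summit.AtomisticToContinuum.FouriersLaw.Theses.BondHeatUncertainty.ExtensiveSnapshotIrreversibility)
    (hZ : ∀ ω₂ lam β γ : ℝ, 0 < ω₂ → 0 < lam → 0 < β → ∀ T : ℝ, 0 < T →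
      ∀ μ : Measure ChainConfig, (pinnedChain ω₂ lam β γ).IsChainGibbsMeasure T μ → IsShiftInvariant μ →
        μ.map (fun σ : ChainConfig => fun x : ℤ => ((σ x).1, -(σ x).2)) = μ →
        ∀ D : InfiniteChainDynamics (pinnedChain ω₂ lam β γ), D.PreservesMeasure μ →
          (∀ t : ℝ, ∀ᵐ σ ∂μ, D.flow t (shift σ) = shift (D.flow t σ)) →
          (∀ t : ℝ, D.HasAbsConvergentCorrelation μ t) →
          Tendsto (fun τ : ℝ => τ⁻¹ * ∫ t in (0:ℝ)..τ, D.currentCorrelation μ t) atTop (𝓝 0)) :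
    Summit.AtomisticToContinuum.FouriersLaw.Theses.JunctionLocality.NonBallistic :=
  nonBallistic_of_subballisticTransitWindow hK (subballisticTransitWindow_of_zeroDrudeWeightInfiniteChain hZ)

/-! ### §3 The supply line: Z is a filed item of route `CurrentTiltQuench` -/

/-- **Z is a filed item of route `CurrentTiltQuench`**: `DrudeFromTruncation` (stmt-AtomisticToContinuum-11032) and `NoTruncatedDrude`
(stmt-AtomisticToContinuum-11030) give zero Drude weight of the infinite chain by modus ponens at each admissible pair. [folklore] -/
theorem zeroDrudeWeightInfiniteChain_of_currentTiltQuench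
    (h32 : Summit.AtomisticToContinuum.FouriersLaw.Theses.CurrentTiltQuench.DrudeFromTruncation)
    (h30 : Summit.AtomisticToContinuum.FouriersLaw.Theses.CurrentTiltQuench.NoTruncatedDrude) :
    ∀ ω₂ lam β γ : ℝ, 0 < ω₂ → 0 < lam → 0 < β → ∀ T : ℝ, 0 < T →
      ∀ μ : Measure ChainConfig, (pinnedChain ω₂ lam β γ).IsChainGibbsMeasure T μ → IsShiftInvariant μ →
        μ.map (fun σ : ChainConfig => fun x : ℤ => ((σ x).1, -(σ x).2)) = μ →
        ∀ D : InfiniteChainDynamics (pinnedChain ω₂ lam β γ), D.PreservesMeasure μ →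
          (∀ t : ℝ, ∀ᵐ σ ∂μ, D.flow t (shift σ) = shift (D.flow t σ)) →
          (∀ t : ℝ, D.HasAbsConvergentCorrelation μ t) →
          Tendsto (fun τ : ℝ => τ⁻¹ * ∫ t in (0:ℝ)..τ, D.currentCorrelation μ t) atTop (𝓝 0) := by
  intro ω₂ lam β γ hω hl hβ T hT μ hG hS hR D hP hcomm hAC
  exact h32 ω₂ lam β γ hω hl hβ T hT μ hG hS hR D hP hcomm hAC
    (fun M hM F hF => h30 ω₂ lam β γ hω hl hβ T hT μ hG hS hR D hP hcomm M hM F hF)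

/-- **`NonBallistic ⟸ stmt-9121 ∧ stmt-11030 ∧ stmt-11032`**: with the open core supplied by route `CurrentTiltQuench`, the crux needs only (K).
[folklore] -/
theorem nonBallistic_of_extensiveSnapshotIrreversibility_of_currentTiltQuench
    (hK : Summit.AtomisticToContinuum.FouriersLaw.Theses.BondHeatUncertainty.ExtensiveSnapshotIrreversibility)
    (h32 : Summit.AtomisticToContinuum.FouriersLaw.Theses.CurrentTiltQuench.DrudeFromTruncation)
    (h30 : Summit.AtomisticToContinuum.FouriersLaw.Theses.CurrentTiltQuench.NoTruncatedDrude) :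
    Summit.AtomisticToContinuum.FouriersLaw.Theses.JunctionLocality.NonBallistic :=
  nonBallistic_of_extensiveSnapshotIrreversibility_of_zeroDrudeWeight hK (zeroDrudeWeightInfiniteChain_of_currentTiltQuench h32 h30)

end Summit.AtomisticToContinuum.FouriersLaw.Theorems.NonBallistic

end
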